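/-
Copyright (c) 2026 the pub-hodgecm-mathlib formalisation cell (harness21).  Prover seat hodgecm-mathlib-LH4-p05 (g8), Track A «(D-RAM) FOUR-FRAME» squad, helper lane on
h413 = stmt-HodgeConjecture-24833 (count-neutral).  Heir dealer∕pen LH4-plan (g13) WORD #58 RULING B (ii) «(β) PRODUCER — model form first, statement-first lane»; directive D-1b §4
(ED. 6 letter `stub_law_cleanSgn : ∀ σ ϖ d t, DyadicFence (CleanSgnFrameConstLawAt n0DerivedOfRecord mcOfRecord σ ϖ d t)`).  2026-09-04.
-/
import Summits.HodgeConjecture.HodgeConjecture.Theorems.F0P3cDyRamLabelCountDiagonalModel    -- ★ p859223 (LH4-p13 (g8), (L-lab-7)): `transvPlusFixCount_conj_eq`, `latticeLabelPlus_conj_mapGL_iff`, `pairing_diagonal_mulVec_diagonal_three`; brings ★ p858764 (L-model) `ncard_vertex_fixed_sep_formCongr_eq`, `coe_conj_sub_one`, `latticeNearTransvShell_conj_mapGL_iff`, `diagonal_three_sub_one(_mul_self)`, `eq_conj_of_coe_eq_frameElt`, ★ `exists_unimodular_diagonal_frame`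
import Summits.HodgeConjecture.HodgeConjecture.Theorems.F0P3cDyRamStageOneBDerivedDefs      -- ★ p859675 DEFS LEAF №6 (this seat): (β) `CleanSgnFrameConstLawAt`; brings ★ p859562 №5 `cleanMinusFixCount`, `mcOfRecord`, …
import HarnessLib

/-!
# Crux `H413`, line LH4 «(D-RAM) FOUR-FRAME» — (β) IN MODEL FORM: the clean sign census `T+ − T−′` of a four-frame family is frame-constant AS SOON AS the labelled
# difference count of the unimodular diagonal model depends on the model units only through an admissible-class-blind law (the reduction, sorry-free; the model law a HYPOTHESIS)

Cell `hodgecm-mathlib` (D-0151), FLOOR 0, crux item H413 = `stmt-HodgeConjecture-24833`, route `HCCMUnconditional`; squad F0∕P3c∕LH4.  THEOREMS ONLY (no `def`, no instance, no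
notation, no `sorry`, default heartbeats); lane `--supports stmt-HodgeConjecture-24833 --as helper`; pays NO row, states NO law.

WHY (D-1b §4, ED. 6: the one genuinely LABELLED census statement of the derived T₊ road is (β) `CleanSgnFrameConstLawAt N₀ mc` (★ №6): on a type-(1) four-frame family at an element
datum, `transvPlusFixCount (ℓ₀, m*) (Γ_b) − cleanMinusFixCount (ℓ₀, m*, mc) (Γ_b)` takes ONE value on the four frames; F0P3-p01 (g35) REFIT f25b87ca: 35∕35 wild rows, the value is a
NONZERO constant, e.g. (7,7,11): 32 − 96 in every frame).  STEP (1) OF ITS (K)∕(S)-STYLE REDUCTION (the pattern of ★ p855032 ∕ ★ p858764 ∕ ★ p859223): put BOTH labelled counts of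
the frame `Γ_b = A_b·diag(α,β,1)·A_b⁻¹` into LH4-p13 (g8)'s unimodular diagonal model `ᵗσ(A_b)Φ₃A_b = diag(c^{(b)})` (`|c_i| = 1`, `σc_i = c_i`, `ω(c_i) = ω(N(f b i))`), where the label
reads the BINARY NORM-FORM CLASS `{c₀(α−1)N(y₀) + c₁(β−1)N(y₁) | y ∈ M} + ϖ^{m}𝒪 = t₊N(𝒪) + ϖ^{m}𝒪` — §1 the `T−′` twin `cleanMinusFixCount_conj_eq ∕ _conj_diagonal` of ★ p859223's
`transvMinusFixCount_conj_eq ∕ _conj_diagonal` (shell square level `mc`, label precision `m`), §2 both counts of ONE frame in ONE model with the SAME units `c` (`exists_diagonal_model_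
transvPlus_cleanMinus`).  The frame enters the model only through `c^{(b)}`, and by ★ #0a H7 every frame's `c^{(b)}` is ADMISSIBLE: `ω(c₂) = ω(−1)·ω(c₀)·ω(c₁)` (the determinant
coset).  §3 THE MODEL FORM OF (β): IF the labelled DIFFERENCE count `D(c, T) := #T+(diag c, T) − #T−′(diag c, T)` takes the same value on any two admissible unit triples `c, c′`
(hypothesis `hmodel`, spelled inline — the census statement LH4-p09 (g8)'s labelled strata ∕ F0P3a-p01 (g35)'s STRATA engines are to pay, stratum by stratum), THEN (β) holds at that
datum (`cleanSgnFrameConstLawAt_of_modelDiff`).  By ★ p859223 (C) `ncard_labelled_diagonal_eq_of_exists_norm` `D(c, T)` already depends on `c` only through `(ω(c₀), ω(c₁), ω(c₂))`,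
so `hmodel` is a statement about the FOUR admissible sign classes — the determinant coset of `(ℤ∕2)³` — not about units.
HONEST LABEL.  Count-neutral; the model law is a HYPOTHESIS (a census target, nothing asserted); (β) and the tier-0 T₊ row stay OPEN; `HC_CM` is proved only modulo the 7 printed
citations (2 remaining named inputs: hLiu418 = `stmt-HodgeConjecture-24832`, h413 = `stmt-HodgeConjecture-24833`) until rung 0 closes.

## References
* [Rogawski1990] J. D. Rogawski, *Automorphic Representations of Unitary Groups in Three Variables*, Ann. of Math. Stud. 123 (1990): §4.9 Prop. 4.9.1 (a)(b) p. 55; §3.6 pp. 28–29.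
* [Kottwitz1986BaseChangeUnits] R. E. Kottwitz, *Base change for unit elements of Hecke algebras*, Compositio Math. 60 (1986), §1 pp. 240–241.
* [Jacobowitz1962] R. Jacobowitz, *Hermitian forms over local fields*, Amer. J. Math. 84 (1962), §4.
* [LanglandsShelstad1987] R. P. Langlands, D. Shelstad, *On the definition of transfer factors*, Math. Ann. 278 (1987), §1.3, §3.
-/

set_option autoImplicit false

noncomputable section

namespace Summit.HodgeConjecture.HodgeConjecture.Cruxes.H413.F0P3cDyRamCleanSgnModelForm

open Literature.NumberTheory.Automorphic Literature.NumberTheory.Automorphic.HermitianLattice Literature.NumberTheory.Automorphic.UnitaryGroup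
open Literature.NumberTheory.Automorphic.UnitaryLatticeTree Literature.NumberTheory.Automorphic.UnitaryThreeFourFrame
open Summit.HodgeConjecture.HodgeConjecture.Cruxes.H413.F0P3cDyRamFourFramePieces
open Summit.HodgeConjecture.HodgeConjecture.Cruxes.H413.F0P3cDyRamFourFrameCensusDefs
open Summit.HodgeConjecture.HodgeConjecture.Cruxes.H413.F0P3cDyRamFixedCountDiagonalModel (exists_unimodular_diagonal_frame)
open Summit.HodgeConjecture.HodgeConjecture.Cruxes.H413.F0P3cDyRamLevelCountDiagonalModel
open Summit.HodgeConjecture.HodgeConjecture.Cruxes.H413.F0P3cDyRamLabelCountDiagonalModel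
open Summit.HodgeConjecture.HodgeConjecture.Cruxes.H413.F0P3cDyRamStageOneBDefs
open Summit.HodgeConjecture.HodgeConjecture.Cruxes.H413.F0P3cDyRamStageOneBDerivedDefs
open scoped Valued WithZero Matrix MatrixGroups

/-! ## §1  The `T−′` count of a conjugate in the model (twin of ★ p859223 §3 for `cleanMinusFixCount`: shell square level `mc`, label precision `m`) -/

section Transport

variable {K : Type} [Field K] [Valued K ℤᵐ⁰]

/-- **`cleanMinusFixCount` OF A CONJUGATE** (any model `ᵗσ(A)·Φ₃·A = H′`, any `T`): for `Γ = A·T·A⁻¹`, the clean-shell non-`+` count transports to the type-0 vertices of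
`(K³, H′)` fixed by `T`, on the clean shell `(ℓ, mc)` of `T − 1`, whose `H′`-value set at precision `m` is NOT the `+` reference set.
[cite: Kottwitz1986BaseChangeUnits, §1 pp. 240–241] [cite: Rogawski1990, §4.9 Prop. 4.9.1 (b) p. 55] -/
theorem cleanMinusFixCount_conj_eq (σ : K →+* K) (ϖ : K) {H' : Matrix (Fin 3) (Fin 3) K} {A T Γ : GL (Fin 3) K}
    (hA : formCongr σ A ((StdForm.antidiagonal 3).over K) = H') (hΓ : Γ = A * T * A⁻¹) (d ℓ m mc : ℕ) :
    cleanMinusFixCount σ ϖ d ℓ m mc Γ =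
      {M : Submodule 𝒪[K] (Fin 3 → K) | IsVertexLattice σ ϖ H' 0 M ∧ mapGL T M = M ∧
        (LatticeNearTransvShell ϖ ℓ mc ((T : Matrix (Fin 3) (Fin 3) K) - 1) M ∧
          ¬ {v | ∃ y ∈ M, Valued.v ((ϖ ^ m)⁻¹ * (v - pairing σ H' y (((T : Matrix (Fin 3) (Fin 3) K) - 1) *ᵥ y))) ≤ 1} =
            valueSetMod σ ϖ m (xPlus σ ϖ d))}.ncard := by
  subst hΓ
  unfold cleanMinusFixCount
  rw [← hA]
  refine (ncard_vertex_fixed_sep_formCongr_eq σ ϖ ((StdForm.antidiagonal 3).over K) A T 0 _ _ fun M => ?_).symm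
  rw [F0P3cDyRamLevelCountDiagonalModel.coe_conj_sub_one, latticeNearTransvShell_conj_mapGL_iff, latticeLabelPlus_conj_mapGL_iff]

/-- **`cleanMinusFixCount` OF A CONJUGATE OF A DIAGONAL MATRIX** (`T = diag(s)`, model `H′ = diag(c)`): shell tokens of `diag(s − 1)` (level `ℓ`, not `ℓ+1`), `diag((s−1)²)`
(square level `mc`) and the NEGATED label at precision `m`. [cite: Kottwitz1986BaseChangeUnits, §1 pp. 240–241] [cite: Jacobowitz1962, §4] -/
theorem cleanMinusFixCount_conj_diagonal (σ : K →+* K) (ϖ : K) {c : Fin 3 → K} {A T Γ : GL (Fin 3) K}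
    (hA : formCongr σ A ((StdForm.antidiagonal 3).over K) = Matrix.diagonal c) (hΓ : Γ = A * T * A⁻¹) {s : Fin 3 → K}
    (hT : (T : Matrix (Fin 3) (Fin 3) K) = Matrix.diagonal s) (d ℓ m mc : ℕ) :
    cleanMinusFixCount σ ϖ d ℓ m mc Γ =
      {M : Submodule 𝒪[K] (Fin 3 → K) | IsVertexLattice σ ϖ (Matrix.diagonal c) 0 M ∧ mapGL T M = M ∧
        ((LatticeInLevel ϖ ℓ (Matrix.diagonal fun i => s i - 1) M ∧ ¬ LatticeInLevel ϖ (ℓ + 1) (Matrix.diagonal fun i => s i - 1) M ∧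
            LatticeInLevel ϖ mc (Matrix.diagonal fun i => (s i - 1) * (s i - 1)) M) ∧
          ¬ {v | ∃ y ∈ M, Valued.v ((ϖ ^ m)⁻¹ * (v - ∑ i, σ (y i) * c i * ((s i - 1) * y i))) ≤ 1} = valueSetMod σ ϖ m (xPlus σ ϖ d))}.ncard := by
  rw [cleanMinusFixCount_conj_eq σ ϖ hA hΓ, hT, diagonal_sub_one]
  unfold LatticeNearTransvShell
  rw [diagonal_sub_one_mul_self']
  simp only [pairing_diagonal_mulVec_diagonal]

end Transport

/-! ## §2  Both labelled counts of one frame in ONE unimodular diagonal model with the SAME units `c` -/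

section Frame

variable {K : Type} [Field K] [Valued K ℤᵐ⁰] {σ : K →+* K} {ϖ : K}

/-- **THE CLEAN SIGN CENSUS OF A FRAME ELEMENT IN THE UNIMODULAR DIAGONAL MODEL.**  Under the datum clauses, for a four-frame family `f` and a frame `b` there is a unit diagonal
model `diag(c)` (`|c_i| = 1`, `σc_i = c_i`, `ω(c_i) = ω(N(f b i))`) in which, for ALL `α, β`, every `T` with matrix `diag(α, β, 1)`, every `Γ` with matrix `frameElt σ f b α β`
and all `d, ℓ, m, mc`:  `transvPlusFixCount σ ϖ d ℓ m Γ` and `cleanMinusFixCount σ ϖ d ℓ m mc Γ` are the labelled type-0 fixed counts of `(K³, diag(c))` for `T` — shell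
`diag(α−1, β−1, 0)` at level `ℓ` (exactly), square `diag((α−1)², (β−1)², 0)` at level `m` resp. `mc`, binary norm-form class `{c₀(α−1)N(y₀) + c₁(β−1)N(y₁)} + ϖ^m𝒪 = t₊N(𝒪) + ϖ^m𝒪`
resp. NOT.  (★ p859223's HEAD with the `T−′` twin of §1, same `A`, same `c`.) [cite: Rogawski1990, §4.9 Prop. 4.9.1 (a)(b) p. 55] [cite: Kottwitz1986BaseChangeUnits, §1 pp. 240–241]
[cite: LanglandsShelstad1987, §3] -/
theorem exists_diagonal_model_transvPlus_cleanMinus (hσ : ∀ x, σ (σ x) = x) (hvσ : ∀ a, Valued.v (σ a) = Valued.v a)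
    (hϖ : Valued.v ϖ = WithZero.exp (-1 : ℤ)) (heven : ∀ x : K, σ x = x → x ≠ 0 → ∃ n : ℤ, Valued.v x = WithZero.exp (2 * n))
    {f : Fin 4 → Fin 3 → (Fin 3 → K)} (hf : IsFourFrameFamily σ f) (b : Fin 4) :
    ∃ c : Fin 3 → K, (∀ i, Valued.v (c i) = 1) ∧ (∀ i, σ (c i) = c i) ∧
      (∀ i, normSign σ (c i) = normSign σ (pairing σ ((StdForm.antidiagonal 3).over K) (f b i) (f b i))) ∧
      ∀ (α β : K) (T Γ : GL (Fin 3) K), (T : Matrix (Fin 3) (Fin 3) K) = Matrix.diagonal ![α, β, 1] →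
        (Γ : Matrix (Fin 3) (Fin 3) K) = frameElt σ f b α β → ∀ d ℓ m mc : ℕ,
        transvPlusFixCount σ ϖ d ℓ m Γ =
            {M : Submodule 𝒪[K] (Fin 3 → K) | IsVertexLattice σ ϖ (Matrix.diagonal c) 0 M ∧ mapGL T M = M ∧
              ((LatticeInLevel ϖ ℓ (Matrix.diagonal ![α - 1, β - 1, 0]) M ∧ ¬ LatticeInLevel ϖ (ℓ + 1) (Matrix.diagonal ![α - 1, β - 1, 0]) M ∧
                  LatticeInLevel ϖ m (Matrix.diagonal ![(α - 1) * (α - 1), (β - 1) * (β - 1), 0]) M) ∧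
                {v | ∃ y ∈ M, Valued.v ((ϖ ^ m)⁻¹ * (v - (c 0 * (α - 1) * (y 0 * σ (y 0)) + c 1 * (β - 1) * (y 1 * σ (y 1))))) ≤ 1} =
                  valueSetMod σ ϖ m (xPlus σ ϖ d))}.ncard ∧
        cleanMinusFixCount σ ϖ d ℓ m mc Γ =
            {M : Submodule 𝒪[K] (Fin 3 → K) | IsVertexLattice σ ϖ (Matrix.diagonal c) 0 M ∧ mapGL T M = M ∧
              ((LatticeInLevel ϖ ℓ (Matrix.diagonal ![α - 1, β - 1, 0]) M ∧ ¬ LatticeInLevel ϖ (ℓ + 1) (Matrix.diagonal ![α - 1, β - 1, 0]) M ∧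
                  LatticeInLevel ϖ mc (Matrix.diagonal ![(α - 1) * (α - 1), (β - 1) * (β - 1), 0]) M) ∧
                ¬ {v | ∃ y ∈ M, Valued.v ((ϖ ^ m)⁻¹ * (v - (c 0 * (α - 1) * (y 0 * σ (y 0)) + c 1 * (β - 1) * (y 1 * σ (y 1))))) ≤ 1} =
                  valueSetMod σ ϖ m (xPlus σ ϖ d))}.ncard := by
  obtain ⟨A, c, hc, hσc, hcls, hA, hconj⟩ := exists_unimodular_diagonal_frame hσ hvσ hϖ heven hf b
  refine ⟨c, hc, hσc, hcls, fun α β T Γ hT hΓ d ℓ m mc => ?_⟩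
  have hΓ' : Γ = A * T * A⁻¹ := eq_conj_of_coe_eq_frameElt hconj hT hΓ
  have hD₁ : Matrix.diagonal ![α, β, (1 : K)] - 1 = Matrix.diagonal ![α - 1, β - 1, 0] := by rw [diagonal_three_sub_one, sub_self]
  have hD₂ : (Matrix.diagonal ![α, β, (1 : K)] - 1) * (Matrix.diagonal ![α, β, 1] - 1) = Matrix.diagonal ![(α - 1) * (α - 1), (β - 1) * (β - 1), 0] := by
    rw [diagonal_three_sub_one_mul_self, sub_self, mul_zero]
  constructor
  · rw [transvPlusFixCount_conj_eq σ ϖ hA hΓ', hT]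
    unfold LatticeNearTransvShell
    rw [hD₂, hD₁]
    simp only [pairing_diagonal_mulVec_diagonal_three]
  · rw [cleanMinusFixCount_conj_eq σ ϖ hA hΓ', hT]
    unfold LatticeNearTransvShell
    rw [hD₂, hD₁]
    simp only [pairing_diagonal_mulVec_diagonal_three]

omit [Valued K ℤᵐ⁰] in
/-- ADMISSIBILITY OF A FRAME'S MODEL UNITS: by ★ #0a H7 (`IsFourFrameFamily`: `ω(N f_b,0) = ε₁(b)`, `ω(N f_b,1) = ε₂(b)`, `ω(N f_b,2) = ω(−1)·ε₁(b)·ε₂(b)`), units with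
`ω(c_i) = ω(N(f b i))` lie in the DETERMINANT COSET `ω(c₂) = ω(−1)·ω(c₀)·ω(c₁)` — the only way the frame enters the model. [cite: Jacobowitz1962, §4] [cite: Rogawski1990, §3.6 pp. 28–29] -/
theorem normSign_two_eq_of_frame_classes {f : Fin 4 → Fin 3 → (Fin 3 → K)} (hf : IsFourFrameFamily σ f) (b : Fin 4) {c : Fin 3 → K}
    (hcls : ∀ i, normSign σ (c i) = normSign σ (pairing σ ((StdForm.antidiagonal 3).over K) (f b i) (f b i))) :
    normSign σ (c 2) = normSign σ (-1) * normSign σ (c 0) * normSign σ (c 1) := by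
  obtain ⟨-, -, h0, h1, h2⟩ := hf b
  rw [hcls 2, hcls 0, hcls 1, h0, h1, h2]

/-! ## §3  THE MODEL FORM OF (β): an admissible-class-blind labelled difference law in the diagonal model ⟹ `CleanSgnFrameConstLawAt` -/

/-- **(β) FROM ITS MODEL FORM.**  Fix schedules `N₀, mc` and a datum `(σ, ϖ, d, t)`.  SUPPOSE (`hmodel`, a census statement — nothing asserted here) that for every element datum
`(α, β)` at threshold `N₀ d`, every `T` with matrix `diag(α, β, 1)` and ANY TWO admissible unit triples `c, c′` (`|c_i| = 1`, `σ c_i = c_i`, determinant coset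
`ω(c₂) = ω(−1)·ω(c₀)·ω(c₁)`), the labelled DIFFERENCE counts of the two models agree:
`#T+(diag c, T) − #T−′(diag c, T) = #T+(diag c′, T) − #T−′(diag c′, T)` (shell `(ℓ₀, m*)` ∕ clean shell `(ℓ₀, m*, mc d)`, label precision `m*`, as in §2).  THEN (β)
`CleanSgnFrameConstLawAt N₀ mc σ ϖ d t`: every frame's counts are such model counts (§2) at admissible units (`normSign_two_eq_of_frame_classes`), so all four differences equal the
first frame's. [cite: Rogawski1990, §4.9 Prop. 4.9.1 (a)(b) p. 55] [cite: LanglandsShelstad1987, §1.3, §3] [cite: Kottwitz1986BaseChangeUnits, §1 pp. 240–241] -/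
theorem cleanSgnFrameConstLawAt_of_modelDiff [CompleteSpace K] [Fintype 𝓀[K]] (N₀ mc : ℕ → ℕ) (σ : K →+* K) (ϖ : K) (d t : ℕ)
    (hmodel : ∀ (α β : K) (n₁ n₂ n₃ : ℕ), IsElementDatum σ ϖ (N₀ d) α β n₁ n₂ n₃ →
      ∀ (T : GL (Fin 3) K), (T : Matrix (Fin 3) (Fin 3) K) = Matrix.diagonal ![α, β, 1] →
      ∀ (c c' : Fin 3 → K), (∀ i, Valued.v (c i) = 1) → (∀ i, σ (c i) = c i) → normSign σ (c 2) = normSign σ (-1) * normSign σ (c 0) * normSign σ (c 1) →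
        (∀ i, Valued.v (c' i) = 1) → (∀ i, σ (c' i) = c' i) → normSign σ (c' 2) = normSign σ (-1) * normSign σ (c' 0) * normSign σ (c' 1) →
        (({M : Submodule 𝒪[K] (Fin 3 → K) | IsVertexLattice σ ϖ (Matrix.diagonal c) 0 M ∧ mapGL T M = M ∧
              ((LatticeInLevel ϖ (d % 2) (Matrix.diagonal ![α - 1, β - 1, 0]) M ∧ ¬ LatticeInLevel ϖ (d % 2 + 1) (Matrix.diagonal ![α - 1, β - 1, 0]) M ∧
                  LatticeInLevel ϖ (mstarOfRecord d) (Matrix.diagonal ![(α - 1) * (α - 1), (β - 1) * (β - 1), 0]) M) ∧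
                {v | ∃ y ∈ M, Valued.v ((ϖ ^ mstarOfRecord d)⁻¹ * (v - (c 0 * (α - 1) * (y 0 * σ (y 0)) + c 1 * (β - 1) * (y 1 * σ (y 1))))) ≤ 1} =
                  valueSetMod σ ϖ (mstarOfRecord d) (xPlus σ ϖ d))}.ncard : ℤ) -
          ({M : Submodule 𝒪[K] (Fin 3 → K) | IsVertexLattice σ ϖ (Matrix.diagonal c) 0 M ∧ mapGL T M = M ∧
              ((LatticeInLevel ϖ (d % 2) (Matrix.diagonal ![α - 1, β - 1, 0]) M ∧ ¬ LatticeInLevel ϖ (d % 2 + 1) (Matrix.diagonal ![α - 1, β - 1, 0]) M ∧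
                  LatticeInLevel ϖ (mc d) (Matrix.diagonal ![(α - 1) * (α - 1), (β - 1) * (β - 1), 0]) M) ∧
                ¬ {v | ∃ y ∈ M, Valued.v ((ϖ ^ mstarOfRecord d)⁻¹ * (v - (c 0 * (α - 1) * (y 0 * σ (y 0)) + c 1 * (β - 1) * (y 1 * σ (y 1))))) ≤ 1} =
                  valueSetMod σ ϖ (mstarOfRecord d) (xPlus σ ϖ d))}.ncard : ℤ)) =
        (({M : Submodule 𝒪[K] (Fin 3 → K) | IsVertexLattice σ ϖ (Matrix.diagonal c') 0 M ∧ mapGL T M = M ∧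
              ((LatticeInLevel ϖ (d % 2) (Matrix.diagonal ![α - 1, β - 1, 0]) M ∧ ¬ LatticeInLevel ϖ (d % 2 + 1) (Matrix.diagonal ![α - 1, β - 1, 0]) M ∧
                  LatticeInLevel ϖ (mstarOfRecord d) (Matrix.diagonal ![(α - 1) * (α - 1), (β - 1) * (β - 1), 0]) M) ∧
                {v | ∃ y ∈ M, Valued.v ((ϖ ^ mstarOfRecord d)⁻¹ * (v - (c' 0 * (α - 1) * (y 0 * σ (y 0)) + c' 1 * (β - 1) * (y 1 * σ (y 1))))) ≤ 1} =
                  valueSetMod σ ϖ (mstarOfRecord d) (xPlus σ ϖ d))}.ncard : ℤ) -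
          ({M : Submodule 𝒪[K] (Fin 3 → K) | IsVertexLattice σ ϖ (Matrix.diagonal c') 0 M ∧ mapGL T M = M ∧
              ((LatticeInLevel ϖ (d % 2) (Matrix.diagonal ![α - 1, β - 1, 0]) M ∧ ¬ LatticeInLevel ϖ (d % 2 + 1) (Matrix.diagonal ![α - 1, β - 1, 0]) M ∧
                  LatticeInLevel ϖ (mc d) (Matrix.diagonal ![(α - 1) * (α - 1), (β - 1) * (β - 1), 0]) M) ∧
                ¬ {v | ∃ y ∈ M, Valued.v ((ϖ ^ mstarOfRecord d)⁻¹ * (v - (c' 0 * (α - 1) * (y 0 * σ (y 0)) + c' 1 * (β - 1) * (y 1 * σ (y 1))))) ≤ 1} =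
                  valueSetMod σ ϖ (mstarOfRecord d) (xPlus σ ϖ d))}.ncard : ℤ))) :
    CleanSgnFrameConstLawAt N₀ mc σ ϖ d t := by
  intro hD f hf α β n₁ n₂ n₃ hE Γ hΓ
  obtain ⟨hσσ, hvσ, hvϖ, heven, -, -, -⟩ := hD
  obtain ⟨hα, hβ, -⟩ := id hE
  -- `T = diag(α, β, 1)` as an element of `GL₃` (`α, β` are norm-one, hence non-zero)
  have hα0 : α ≠ 0 := fun h => by rw [h, zero_mul] at hα; exact zero_ne_one hα
  have hβ0 : β ≠ 0 := fun h => by rw [h, zero_mul] at hβ; exact zero_ne_one hβ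
  have hdet : (Matrix.diagonal ![α, β, (1 : K)]).det ≠ 0 := by
    rw [Matrix.det_diagonal, Fin.prod_univ_three]
    simp [hα0, hβ0]
  set T : GL (Fin 3) K := Matrix.GeneralLinearGroup.mkOfDetNeZero _ hdet with hTdef
  have hT : (T : Matrix (Fin 3) (Fin 3) K) = Matrix.diagonal ![α, β, 1] := rfl
  -- the model data of each frame
  have hmod := fun b' : Fin 4 => exists_diagonal_model_transvPlus_cleanMinus (ϖ := ϖ) hσσ hvσ hvϖ heven hf b'
  choose c hc hσc hcls hcount using hmod
  have hadm : ∀ b', normSign σ (c b' 2) = normSign σ (-1) * normSign σ (c b' 0) * normSign σ (c b' 1) :=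
    fun b' => normSign_two_eq_of_frame_classes hf b' (hcls b')
  refine ⟨(transvPlusFixCount σ ϖ d (d % 2) (mstarOfRecord d) (Γ 0) : ℤ) - (cleanMinusFixCount σ ϖ d (d % 2) (mstarOfRecord d) (mc d) (Γ 0) : ℤ), fun b' => ?_⟩
  obtain ⟨hP, hM⟩ := hcount b' α β T (Γ b') hT (hΓ b') d (d % 2) (mstarOfRecord d) (mc d)
  obtain ⟨hP0, hM0⟩ := hcount 0 α β T (Γ 0) hT (hΓ 0) d (d % 2) (mstarOfRecord d) (mc d)
  rw [hP, hM, hP0, hM0]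
  exact hmodel α β n₁ n₂ n₃ hE T hT (c b') (c 0) (hc b') (hσc b') (hadm b') (hc 0) (hσc 0) (hadm 0)

end Frame

end Summit.HodgeConjecture.HodgeConjecture.Cruxes.H413.F0P3cDyRamCleanSgnModelForm

end
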